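import Summits.Ventures.PercRepro.SingleMergeDim
import Summits.Ventures.PercRepro.ColumnSum
import Summits.Ventures.PercRepro.LemmaBPointed

/-!
# The dimension lemma: single merge and three crossing-pair types force `|S| ≥ 8`; Lemma B below 8

For a single-merge monotone map `c : Config S → Setoid (Fin 4)` (`SingleMergeMap c`, every cube
edge stays or performs one block merge — what every percolation map of a marked multigraph does):

* `not_isSingleMerge_bot_cross4`: `⊥ → x_k` is not a single merge (a crossing partition has two
  two-element blocks, a single merge from the discrete partition has one);
* `card_openEdges_add_two_le`: if `ω ≤ σ`, `c ω = ⊥` and `c σ` is a crossing cell, then `σ` has at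
  least two more open coordinates than `ω` — one missing coordinate would be a single merge `⊥ → x_k`;
* `card_inter_add_two_le` **(P)**: two crossing points of different cells overlap in at most
  `|α| − 2` coordinates (their meet has cell `⊥`);
* `eight_le_card_of_threeTypes` **(the dimension lemma)**: with a pair `(σ, σᶜ)` of cells `(x_i, x_j)`
  and a point `τ` of the third cell, (P) four times gives `|τ| ≤ (|σ| − 2) + (|τ| − 2)` and
  `|τ| ≤ (|τ| − 2) + (|σᶜ| − 2)`, i.e. `|σ|, |σᶜ| ≥ 4`, so `|S| ≥ 8`
  (`HOME/proofs/P4-components.md` §10 (c)–(d), with a shorter proof);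
* `crossCount_le_topBotCount_of_card_le_seven` **(Lemma B below 8)**: a single-merge map on at most
  seven coordinates has at most two crossing-pair types, so one cell meets every crossing pair and
  typer-2's column lemma (Marica–Schönheim on that cell) gives `crossCount cross4 c ≤ topBotCount c`.

Consequently Lemma B holds for every sub-cube of every marked multigraph with at most seven edges.
-/

namespace PercRepro

open Finset

section Dim

variable {S : Type} [Fintype S] [DecidableEq S]

/-- `⊥ → x_k` is not a single merge. -/
theorem not_isSingleMerge_bot_cross4 (k : Fin 3) :
    ¬ IsSingleMerge (⊥ : Setoid (Fin 4)) (cross4 k) := by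
  rintro ⟨i, j, -, h⟩
  have key : ∀ (k : Fin 3) (i j : Fin 4), ∃ x y : Fin 4,
      (![![0, 0, 1, 1], ![0, 1, 0, 1], ![0, 1, 1, 0]] k : Fin 4 → ℕ) x =
        ![![0, 0, 1, 1], ![0, 1, 0, 1], ![0, 1, 1, 0]] k y ∧
      ¬ (x = y ∨ (x = i ∧ j = y) ∨ (x = j ∧ i = y)) := by decide
  obtain ⟨x, y, hxy, hn⟩ := key k i j
  have h1 : cross4 k x y := (cross4_rel k x y).2 hxy
  rw [h, mergeBlocks_rel] at h1
  exact hn h1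

omit [DecidableEq S] in
/-- Two configurations with the same open coordinates are equal. -/
theorem config_eq_of_openEdges_eq {ω σ : Config S} (h : openEdges ω = openEdges σ) : ω = σ := by
  funext e
  have h1 : ω e = true ↔ σ e = true := by
    rw [← mem_openEdges, ← mem_openEdges, h]
  cases hω : ω e <;> cases hσ : σ e <;> simp_all

omit [DecidableEq S] in
/-- Open edges are monotone in the configuration. -/
theorem openEdges_subset_of_le {ω σ : Config S} (h : ω ≤ σ) : openEdges ω ⊆ openEdges σ := by
  intro e he
  rw [mem_openEdges] at he ⊢
  exact Bool.le_iff_imp.1 (h e) he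

/-- The open edges of a meet are the intersection of the open edges. -/
theorem openEdges_inf (ω σ : Config S) : openEdges (ω ⊓ σ) = openEdges ω ∩ openEdges σ := by
  ext e
  simp only [mem_openEdges, Finset.mem_inter, Pi.inf_apply]
  cases ω e <;> cases σ e <;> simp

/-- The open edges of the complement are the complement of the open edges. -/
theorem openEdges_compl (ω : Config S) : openEdges ωᶜ = (openEdges ω)ᶜ := by
  ext e
  simp only [mem_openEdges, Finset.mem_compl, Pi.compl_apply]
  cases ω e <;> simp

/-- Adding the one missing coordinate of `σ` to `ω`. -/
theorem eq_update_of_sdiff_eq_singleton {ω σ : Config S} (hle : ω ≤ σ) {e : S}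
    (h : openEdges σ \ openEdges ω = {e}) : σ = Function.update ω e true := by
  have he : e ∈ openEdges σ \ openEdges ω := by rw [h]; exact Finset.mem_singleton_self e
  rw [Finset.mem_sdiff, mem_openEdges, mem_openEdges] at he
  funext x
  by_cases hx : x = e
  · subst hx; rw [Function.update_self]; exact he.1
  · rw [Function.update_of_ne hx]
    cases hσ : σ x
    · have := Bool.le_iff_imp.1 (hle x)
      cases hω : ω x
      · rfl
      · exact absurd (this hω) (by rw [hσ]; decide)
    · -- `x ∈ openEdges σ`, `x ≠ e`, so `x ∈ openEdges ω`
      by_contra hω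
      have hx' : x ∈ openEdges σ \ openEdges ω := by
        rw [Finset.mem_sdiff, mem_openEdges, mem_openEdges]
        exact ⟨hσ, fun h => hω h.symm⟩
      rw [h, Finset.mem_singleton] at hx'
      exact hx hx'

/-- **Two coordinates below a crossing point.** -/
theorem card_openEdges_add_two_le (c : Config S → Setoid (Fin 4)) (hsm : SingleMergeMap c)
    {ω σ : Config S} (hle : ω ≤ σ) (hω : c ω = ⊥) {k : Fin 3} (hσ : c σ = cross4 k) :
    (openEdges ω).card + 2 ≤ (openEdges σ).card := by
  classical
  have hsub : openEdges ω ⊆ openEdges σ := openEdges_subset_of_le hle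
  by_contra hlt
  have hlt' : (openEdges σ).card < (openEdges ω).card + 2 := Nat.lt_of_not_le hlt
  have hdiff : (openEdges σ \ openEdges ω).card ≤ 1 := by
    rw [Finset.card_sdiff_of_subset hsub]; omega
  rcases Nat.le_one_iff_eq_zero_or_eq_one.1 hdiff with h0 | h1
  · rw [Finset.card_eq_zero, Finset.sdiff_eq_empty_iff_subset] at h0
    have heq : ω = σ := config_eq_of_openEdges_eq (Finset.Subset.antisymm hsub h0)
    rw [heq, hσ] at hω
    exact cross4_ne_bot k hω
  · rw [Finset.card_eq_one] at h1
    obtain ⟨e, he⟩ := h1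
    have hωe : ω e = false := by
      have hmem : e ∈ openEdges σ \ openEdges ω := by rw [he]; exact Finset.mem_singleton_self e
      simp only [Finset.mem_sdiff, mem_openEdges] at hmem
      cases h : ω e
      · rfl
      · exact absurd h hmem.2
    have hupd : σ = Function.update ω e true := eq_update_of_sdiff_eq_singleton hle he
    rcases hsm ω e hωe with h | h
    · rw [← hupd, hσ, hω] at h
      exact cross4_ne_bot k h.symm
    · rw [← hupd, hσ, hω] at h
      exact not_isSingleMerge_bot_cross4 k h

/-- **(P)**: crossing points of different cells overlap in at most `|α| − 2` coordinates. -/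
theorem card_inter_add_two_le (c : Config S → Setoid (Fin 4)) (hc : Monotone c)
    (hsm : SingleMergeMap c) {α β : Config S} {p q : Fin 3} (hpq : p ≠ q)
    (hα : c α = cross4 p) (hβ : c β = cross4 q) :
    (openEdges α ∩ openEdges β).card + 2 ≤ (openEdges α).card := by
  have hmeet : c (α ⊓ β) = ⊥ := by
    apply le_bot_iff.1
    calc c (α ⊓ β) ≤ c α ⊓ c β := le_inf (hc inf_le_left) (hc inf_le_right)
      _ = ⊥ := by rw [hα, hβ, cross4_inf_eq_bot hpq]
  have := card_openEdges_add_two_le c hsm (inf_le_left : α ⊓ β ≤ α) hmeet hα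
  rwa [openEdges_inf] at this

/-- **Every crossing point of a three-type single-merge map has at least four open coordinates**
(and so has its antipode): with a crossing point `τ` of the third cell, (P) four times. -/
theorem four_le_card_openEdges_of_crossing (c : Config S → Setoid (Fin 4)) (hc : Monotone c)
    (hsm : SingleMergeMap c) (h3 : ThreeTypes c) {σ : Config S} {i j : Fin 3} (hij : i ≠ j)
    (hσ : c σ = cross4 i) (hσc : c σᶜ = cross4 j) : 4 ≤ (openEdges σ).card := by
  classical
  have key : ∀ i j : Fin 3, i ≠ j → ∃ k : Fin 3, k ≠ i ∧ k ≠ j := by decide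
  obtain ⟨k, hki, hkj⟩ := key i j hij
  obtain ⟨τ', -, hτ⟩ := h3 i k (Ne.symm hki)
  have A1 := card_inter_add_two_le c hc hsm hki hτ hσ
  have A2 := card_inter_add_two_le c hc hsm (Ne.symm hki) hσ hτ
  have B1 := card_inter_add_two_le c hc hsm hkj hτ hσc
  have hsplit : (openEdges τ'ᶜ ∩ openEdges σ).card + (openEdges τ'ᶜ ∩ openEdges σᶜ).card =
      (openEdges τ'ᶜ).card := by
    have hsd : openEdges τ'ᶜ ∩ (openEdges σ)ᶜ = openEdges τ'ᶜ \ openEdges σ := by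
      ext e; simp only [Finset.mem_inter, Finset.mem_compl, Finset.mem_sdiff]
    rw [openEdges_compl σ, hsd]
    exact Finset.card_inter_add_card_sdiff _ _
  rw [Finset.inter_comm] at A2
  omega

/-- **The dimension lemma**: a single-merge map with all three crossing-pair types lives on at
least eight coordinates. -/
theorem eight_le_card_of_threeTypes (c : Config S → Setoid (Fin 4)) (hc : Monotone c)
    (hsm : SingleMergeMap c) (h3 : ThreeTypes c) : 8 ≤ Fintype.card S := by
  classical
  obtain ⟨σ, hσ, hσc⟩ := h3 0 1 (by decide)
  obtain ⟨τ', -, hτ⟩ := h3 0 2 (by decide)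
  have A1 := card_inter_add_two_le c hc hsm (by decide : (2 : Fin 3) ≠ 0) hτ hσ
  have A2 := card_inter_add_two_le c hc hsm (by decide : (0 : Fin 3) ≠ 2) hσ hτ
  have B1 := card_inter_add_two_le c hc hsm (by decide : (2 : Fin 3) ≠ 1) hτ hσc
  have B2 := card_inter_add_two_le c hc hsm (by decide : (1 : Fin 3) ≠ 2) hσc hτ
  have hsplit : (openEdges τ'ᶜ ∩ openEdges σ).card + (openEdges τ'ᶜ ∩ openEdges σᶜ).card =
      (openEdges τ'ᶜ).card := by
    have hsd : openEdges τ'ᶜ ∩ (openEdges σ)ᶜ = openEdges τ'ᶜ \ openEdges σ := by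
      ext e; simp only [Finset.mem_inter, Finset.mem_compl, Finset.mem_sdiff]
    rw [openEdges_compl σ, hsd]
    exact Finset.card_inter_add_card_sdiff _ _
  have hS : (openEdges σ).card + (openEdges σᶜ).card = Fintype.card S := by
    rw [openEdges_compl]; exact Finset.card_add_card_compl _
  rw [Finset.inter_comm] at A2 B2
  omega

/-- **Lemma B for single-merge maps on at most seven coordinates**: fewer than three crossing-pair
types, hence one cell meets every crossing pair, hence Marica–Schönheim on that cell. -/
theorem crossCount_le_topBotCount_of_card_le_seven (c : Config S → Setoid (Fin 4))
    (hc : Monotone c) (hsm : SingleMergeMap c) (h7 : Fintype.card S ≤ 7) :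
    crossCount cross4 c ≤ topBotCount c := by
  classical
  have h3 : ¬ ThreeTypes c := fun h3 => by
    have := eight_le_card_of_threeTypes c hc hsm h3; omega
  obtain ⟨i, j, hij, hno⟩ : ∃ i j : Fin 3, i ≠ j ∧
      ∀ ω : Config S, ¬ (c ω = cross4 i ∧ c ωᶜ = cross4 j) := by
    by_contra hcon
    apply h3
    intro i j hij
    by_contra hne
    exact hcon ⟨i, j, hij, fun ω hω => hne ⟨ω, hω⟩⟩
  have key : ∀ i j : Fin 3, i ≠ j → ∃ k : Fin 3, k ≠ i ∧ k ≠ j := by decide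
  obtain ⟨k, hki, hkj⟩ := key i j hij
  refine crossCount_le_topBotCount_of_column cross4 c cross4_isCrossingFamily hc k ?_
  intro a b hak hbk
  rw [Finset.eq_empty_iff_forall_notMem]
  intro ω hω
  rw [mem_crossFam] at hω
  obtain ⟨hab, h1, h2⟩ := hω
  have key2 : ∀ a b i j k : Fin 3, i ≠ j → k ≠ i → k ≠ j → a ≠ k → b ≠ k → a ≠ b →
      (a = i ∧ b = j) ∨ (a = j ∧ b = i) := by decide
  have hcases := key2 a b i j k hij hki hkj hak hbk hab
  rcases hcases with ⟨rfl, rfl⟩ | ⟨rfl, rfl⟩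
  · exact hno ω ⟨h1, h2⟩
  · exact hno ωᶜ ⟨h2, by rw [compl_compl]; exact h1⟩

end Dim

end PercRepro
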